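import Summits.CriticalPhenomena.PercolationContinuityZ3.Theorems.Transplant.FKConnectivityAllQHubCovFiber
import HarnessLib

/-!
# Connectivity correlation inequalities for `φ_{w,q}`, every `q > 0` — the hub covariance bound from fiber counting,
# SUPPORT-RESTRICTED form

Support file (`--supports stmt-CriticalPhenomena-4575`), FK sub-lane `prim-bschramm-fk-1` (gen 6) of the post-continuity
programme; builds on p205010 (kernel theorem, internal audit signed; external expert review pending).  No definitions, no named
facts, no sorries; standard axioms.  Companion of `…AllQHubCovFiber.lean` (`hubCovBoundUnder_of_fiberCount`): the same reduction of
fk-3's hub covariance bound `HubCovBoundUnder (φ_U) q x y z` to the per-level COUNTING CRITERION on two-colourings of fibers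
`(ω₁ ∩ ω₂, ω₁ ∪ ω₂)`, but with the criterion required ONLY on the fibers that carry weight under `U` — `U ≠ 0` on the union and
`U ≠ 1` off the intersection (the other fibers have fiber constant `c(I,J) = 0`).  These are exactly the fibers of the weighted graph
itself (pairs of parameter `0` deleted, pairs of parameter `1` contracted), so this is the form in which a proof of the counting
statement for a CLASS of graphs (closed under the relevant minors) yields the bound — hence, via fk-3's `negCorr_adj_of_threePoint`,
negative correlation of adjacent edges for every `q ∈ (0,1)` — on that class.
[cite: Wagner2006, Conj. 5.3, Conj. 5.4 (p. 13)] [cite: Grimmett2006, §3.9 eq. (3.94) (pp. 63–64); §1.4 eq. (1.20) (p. 15)]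
-/

noncomputable section

namespace Summit.CriticalPhenomena.PercolationContinuityZ3.Theorems

namespace FK

open MeasureTheory Finset Literature.Probability.LatticeModels Literature.Probability.Percolation
open Literature.Probability.Percolation.DecisionTree (ind ind_of_mem ind_of_not_mem ind_nonneg)
open scoped Classical

variable {V : Type*} [Fintype V]

/-- **Hub covariance bound from fiber counting, SUPPORT-RESTRICTED form** (`0 < q ≤ 1`): if for every fiber `(I, J)` of pairs of configurations and every
level `j` the number of BAD pairs `(ω₁ ∈ {x↔y↔z}, ω₂ ∈ {x ∤ y~z} ∪ {x|y|z})` of level `j = k(ω₁)+k(ω₂)` is at most the number of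
C-GOOD pairs `(ω₁ ∈ {x∤y, y~z})` of level `≤ j` plus the number of AB-GOOD pairs `(ω₁ ∈ {xy|z}, ω₂ ∈ {xz|y})` of level `j`, then
`HubCovBoundUnder (φ_{U,q}) q x y z`; here the counting criterion is only required on the fibers `(I, J)` that CARRY WEIGHT under `U` (`U ≠ 0` on `J`, `U ≠ 1` off `I`), i.e. on the fibers of the weighted graph itself (pairs of parameter `0` deleted, pairs of parameter `1` contracted) — the form usable for a CLASS of graphs.  With fk-3's `negCorr_adj_of_threePoint` /
`…HubCovEquiv` this is a `q`-free sufficient condition for negative correlation of the adjacent pairs `xy, xz` at every `q ∈ (0,1)`.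
[cite: Wagner2006, Conj. 5.3, Conj. 5.4 (p. 13)] [cite: Grimmett2006, §3.9 eq. (3.94) (pp. 63–64)] -/
theorem hubCovBoundUnder_of_fiberCount_supp {q : ℝ} (hq0 : 0 < q) (hq1 : q ≤ 1) (U : Sym2 V → unitInterval) (x y z : V)
    (hcount : ∀ (d : BondConfig V × BondConfig V), (∀ g, g ∈ d.2 → ((U g : unitInterval) : ℝ) ≠ 0) →
      (∀ g, g ∉ d.1 → ((U g : unitInterval) : ℝ) ≠ 1) → ∀ (j : ℕ),
      ((((Finset.univ : Finset (BondConfig V × BondConfig V)).filter (fun pr => (pr.1 ∩ pr.2, pr.1 ∪ pr.2) = d)).filter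
          (fun pr => (pr.1 ∈ (openConn x y ∩ openConn x z : Set (BondConfig V)) ∧
            pr.2 ∈ (((openConn x y : Set (BondConfig V))ᶜ ∩ openConn y z) ∪
              ((openConn x y : Set (BondConfig V))ᶜ ∩ (openConn x z : Set (BondConfig V))ᶜ ∩
                (openConn y z : Set (BondConfig V))ᶜ) : Set (BondConfig V))) ∧
            clusterCount pr.1 ∅ + clusterCount pr.2 ∅ = j)).card : ℝ) ≤
        ((((Finset.univ : Finset (BondConfig V × BondConfig V)).filter (fun pr => (pr.1 ∩ pr.2, pr.1 ∪ pr.2) = d)).filter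
          (fun pr => pr.1 ∈ ((openConn x y : Set (BondConfig V))ᶜ ∩ openConn y z : Set (BondConfig V)) ∧
            clusterCount pr.1 ∅ + clusterCount pr.2 ∅ ≤ j)).card : ℝ) +
        ((((Finset.univ : Finset (BondConfig V × BondConfig V)).filter (fun pr => (pr.1 ∩ pr.2, pr.1 ∪ pr.2) = d)).filter
          (fun pr => (pr.1 ∈ (openConn x y ∩ (openConn x z : Set (BondConfig V))ᶜ : Set (BondConfig V)) ∧
            pr.2 ∈ ((openConn x y : Set (BondConfig V))ᶜ ∩ openConn x z : Set (BondConfig V))) ∧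
            clusterCount pr.1 ∅ + clusterCount pr.2 ∅ = j)).card : ℝ)) :
    HubCovBoundUnder (rcMeasureW U q ∅) q x y z := by
  rw [hubCovBoundUnder_iff_threePoint hq0, threePoint_eq_fiber_sum]
  refine Finset.sum_nonneg fun d _ => ?_
  -- fibers that carry no weight contribute nothing
  by_cases hz : ∃ g, (g ∈ d.2 ∧ ((U g : unitInterval) : ℝ) = 0) ∨ (g ∉ d.1 ∧ ((U g : unitInterval) : ℝ) = 1)
  · obtain ⟨g, hg⟩ := hz
    have hc : (∏ g : Sym2 V, (if g ∈ d.1 then (U g : ℝ) * (U g : ℝ) else if g ∈ d.2 then (U g : ℝ) * (1 - (U g : ℝ))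
        else (1 - (U g : ℝ)) * (1 - (U g : ℝ)))) = 0 := by
      refine Finset.prod_eq_zero (Finset.mem_univ g) ?_
      rcases hg with ⟨hg2, h0⟩ | ⟨hg1, h1⟩
      · by_cases hg1 : g ∈ d.1
        · rw [if_pos hg1, h0, mul_zero]
        · rw [if_neg hg1, if_pos hg2, h0, zero_mul]
      · rw [if_neg hg1]
        by_cases hg2 : g ∈ d.2
        · rw [if_pos hg2, h1, sub_self, mul_zero]
        · rw [if_neg hg2, h1, sub_self, mul_zero]
    rw [hc, zero_mul]
  have hs0 : ∀ g, g ∈ d.2 → ((U g : unitInterval) : ℝ) ≠ 0 := fun g hg h0 => hz ⟨g, Or.inl ⟨hg, h0⟩⟩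
  have hs1 : ∀ g, g ∉ d.1 → ((U g : unitInterval) : ℝ) ≠ 1 := fun g hg h1 => hz ⟨g, Or.inr ⟨hg, h1⟩⟩
  refine mul_nonneg (fiberWeight_nonneg _ (fun g => (U g).2.1) (fun g => (U g).2.2) _ _) ?_
  -- match the shape of `fiberPoly_nonneg_of_count`
  have key := fiberPoly_nonneg_of_count
    ((Finset.univ : Finset (BondConfig V × BondConfig V)).filter (fun pr => (pr.1 ∩ pr.2, pr.1 ∪ pr.2) = d))
    (fun pr => clusterCount pr.1 ∅ + clusterCount pr.2 ∅)
    (fun pr => pr.1 ∈ ((openConn x y : Set (BondConfig V))ᶜ ∩ openConn y z : Set (BondConfig V)))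
    (fun pr => pr.1 ∈ (openConn x y ∩ (openConn x z : Set (BondConfig V))ᶜ : Set (BondConfig V)) ∧
      pr.2 ∈ ((openConn x y : Set (BondConfig V))ᶜ ∩ openConn x z : Set (BondConfig V)))
    (fun pr => pr.1 ∈ (openConn x y ∩ openConn x z : Set (BondConfig V)) ∧
      pr.2 ∈ (((openConn x y : Set (BondConfig V))ᶜ ∩ openConn y z) ∪
        ((openConn x y : Set (BondConfig V))ᶜ ∩ (openConn x z : Set (BondConfig V))ᶜ ∩
          (openConn y z : Set (BondConfig V))ᶜ) : Set (BondConfig V)))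
    hq0.le hq1 (hcount d hs0 hs1)
  refine le_trans key (le_of_eq (Finset.sum_congr rfl fun pr _ => ?_))
  -- indicators: `if … then 1 else 0` versus `ind`, and the disjoint union for the bad pairs
  have vAB1 : pr.1 ∈ (openConn x y ∩ (openConn x z : Set (BondConfig V))ᶜ : Set (BondConfig V)) ∧
      pr.2 ∈ ((openConn x y : Set (BondConfig V))ᶜ ∩ openConn x z : Set (BondConfig V)) →
      ind (openConn x y ∩ (openConn x z : Set (BondConfig V))ᶜ) pr.1 *
        ind ((openConn x y : Set (BondConfig V))ᶜ ∩ openConn x z) pr.2 = 1 := by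
    rintro ⟨h1, h2⟩; rw [ind_of_mem h1, ind_of_mem h2, mul_one]
  have vAB0 : ¬ (pr.1 ∈ (openConn x y ∩ (openConn x z : Set (BondConfig V))ᶜ : Set (BondConfig V)) ∧
      pr.2 ∈ ((openConn x y : Set (BondConfig V))ᶜ ∩ openConn x z : Set (BondConfig V))) →
      ind (openConn x y ∩ (openConn x z : Set (BondConfig V))ᶜ) pr.1 *
        ind ((openConn x y : Set (BondConfig V))ᶜ ∩ openConn x z) pr.2 = 0 := by
    intro h
    by_cases h1 : pr.1 ∈ (openConn x y ∩ (openConn x z : Set (BondConfig V))ᶜ : Set (BondConfig V))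
    · rw [ind_of_not_mem (fun h2 => h ⟨h1, h2⟩), mul_zero]
    · rw [ind_of_not_mem h1, zero_mul]
  have vBad1 : pr.1 ∈ (openConn x y ∩ openConn x z : Set (BondConfig V)) ∧
      pr.2 ∈ (((openConn x y : Set (BondConfig V))ᶜ ∩ openConn y z) ∪
        ((openConn x y : Set (BondConfig V))ᶜ ∩ (openConn x z : Set (BondConfig V))ᶜ ∩
          (openConn y z : Set (BondConfig V))ᶜ) : Set (BondConfig V)) →
      ind (openConn x y ∩ openConn x z) pr.1 *
        (ind ((openConn x y : Set (BondConfig V))ᶜ ∩ openConn y z) pr.2 +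
          ind ((openConn x y : Set (BondConfig V))ᶜ ∩ (openConn x z : Set (BondConfig V))ᶜ ∩
            (openConn y z : Set (BondConfig V))ᶜ) pr.2) = 1 := by
    rintro ⟨h1, h2⟩
    rw [ind_of_mem h1, one_mul]
    rcases h2 with h2 | h2
    · have h3 : pr.2 ∉ ((openConn x y : Set (BondConfig V))ᶜ ∩ (openConn x z : Set (BondConfig V))ᶜ ∩
          (openConn y z : Set (BondConfig V))ᶜ : Set (BondConfig V)) := fun h => h.2 h2.2
      rw [ind_of_mem h2, ind_of_not_mem h3, add_zero]
    · have h3 : pr.2 ∉ ((openConn x y : Set (BondConfig V))ᶜ ∩ openConn y z : Set (BondConfig V)) := fun h => h2.2 h.2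
      rw [ind_of_not_mem h3, ind_of_mem h2, zero_add]
  have vBad0 : ¬ (pr.1 ∈ (openConn x y ∩ openConn x z : Set (BondConfig V)) ∧
      pr.2 ∈ (((openConn x y : Set (BondConfig V))ᶜ ∩ openConn y z) ∪
        ((openConn x y : Set (BondConfig V))ᶜ ∩ (openConn x z : Set (BondConfig V))ᶜ ∩
          (openConn y z : Set (BondConfig V))ᶜ) : Set (BondConfig V))) →
      ind (openConn x y ∩ openConn x z) pr.1 *
        (ind ((openConn x y : Set (BondConfig V))ᶜ ∩ openConn y z) pr.2 +
          ind ((openConn x y : Set (BondConfig V))ᶜ ∩ (openConn x z : Set (BondConfig V))ᶜ ∩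
            (openConn y z : Set (BondConfig V))ᶜ) pr.2) = 0 := by
    intro h
    by_cases h1 : pr.1 ∈ (openConn x y ∩ openConn x z : Set (BondConfig V))
    · have h2 : pr.2 ∉ (((openConn x y : Set (BondConfig V))ᶜ ∩ openConn y z) ∪
          ((openConn x y : Set (BondConfig V))ᶜ ∩ (openConn x z : Set (BondConfig V))ᶜ ∩
            (openConn y z : Set (BondConfig V))ᶜ) : Set (BondConfig V)) := fun h2 => h ⟨h1, h2⟩
      rw [ind_of_not_mem (fun h' => h2 (Set.mem_union_left _ h')), ind_of_not_mem (fun h' => h2 (Set.mem_union_right _ h')),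
        add_zero, mul_zero]
    · rw [ind_of_not_mem h1, zero_mul]
  have vC1 : pr.1 ∈ ((openConn x y : Set (BondConfig V))ᶜ ∩ openConn y z : Set (BondConfig V)) →
      ind ((openConn x y : Set (BondConfig V))ᶜ ∩ openConn y z) pr.1 = 1 := fun h => ind_of_mem h
  have vC0 : pr.1 ∉ ((openConn x y : Set (BondConfig V))ᶜ ∩ openConn y z : Set (BondConfig V)) →
      ind ((openConn x y : Set (BondConfig V))ᶜ ∩ openConn y z) pr.1 = 0 := fun h => ind_of_not_mem h
  split_ifs <;>
    (first | rw [vC1 (by assumption)] | rw [vC0 (by assumption)]) <;>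
    (first | rw [vAB1 (by assumption)] | rw [vAB0 (by assumption)]) <;>
    (first | rw [vBad1 (by assumption)] | rw [vBad0 (by assumption)])

end FK

end Summit.CriticalPhenomena.PercolationContinuityZ3.Theorems

end
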